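import Summits.QuantumFields.BalabanUV.T4Continuum.Support.NE7SliceRepresentativeFrames
import Summits.QuantumFields.BalabanUV.T4Continuum.Support.NE7DecompOfDirectLettersSlice
import Summits.QuantumFields.BalabanUV.T4Continuum.Support.NE7RoutePiRegimeSU2
import Summits.QuantumFields.BalabanUV.T4Continuum.Support.AveragingDeficitMultiLevelBridge
import HarnessLib

/-!
# NE7HdecompOfDirectLettersFM — STEP 0 (memo ROAD-G102 §9), third file: `NE7HdecompOfDirectLetters.hdecomp_of_directLetters` with the direct-letter hypothesis WEAKENED to `hDL′` — the letters
# are asked only for slice representatives that ALSO satisfy frame matching `framePotW(T(u)) = h(u)` and zero defect `Df(u) = 0` (the representative of `NE7SliceRepresentativeFrames` does)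

Cell `pub-balaban`, rung (B)+1 sub-cell t4, lineage `b2b-balaban-t4-ne7-p1`, generation 102 (CRUX PROVER NE7 #1 = OWNER of BINDER row NE7).  Memo `t4/b2b-balaban-t4-ne7-p1-g102/ROAD-G102.md` §9.
WHAT ([folklore]; 0 def, 0 sorry).  **`hdecomp_of_directLetters_fm`** — VERBATIM `hdecomp_of_directLetters` with `hDL′` (one more hypothesis line inside the displayed letter).
HONEST FRAMING (page 1): bookkeeping; `hDL′` asserted for nothing; nothing of Bałaban's asserted; NOT (S2), NOT NE7; spine 0∕9; finite T⁴ rung (B)+1 — NOT infinite volume, NOT mass gap, NOT BetaPertH,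
NOT Clay.  Continuum YM on T⁴ ⇐ BetaPertH ∧ nine spine estimates (0/9 proved); BetaPertH ⇐ (D1) ∧ (D4) ∧ CAP+tail; G-an2-4 gates asym, D1 and NE2/3/4.
-/


set_option autoImplicit false

open scoped BigOperators Matrix Matrix.Norms.L2Operator
open NormedSpace Finset Set

namespace Summit.QuantumFields.BalabanUV.T4Continuum.NE7HdecompOfDirectLettersFM

open Literature.MathematicalPhysics.QuantumFieldTheory.Balaban1983to89
open B7Prop1Explicit B7Prop2Explicit MatrixLog
open T4AveragingDeficitWall (IsUnitaryCfg IsSkewDir SmallField vary curl curlSq dirSq dirL1)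
open T4AveragingDeficitWallBoundary (IsPeriodicCfg periodBox)
open AveragingDeficitPeriodicCounting (IsPeriodicDir)
open AveragingDeficitMultiLevelPrep (LevelSmall tower TangentIter cavgIter)
open AveragingDeficitMultiLevelBridge (cavgIter_eq_avgIter)
open MinimalActionLevels (perWin)
open MinimalActionSandwich (admissible)
open MinimalActionRate (sfClass)
open NE3HessForm (dAction)
open NE3EnergyShapes (IsUnitarySite IsPeriodicSite)
open NE3EnergyWeightedShapes (energyNormW)
open NE3QbarIterCovLiftPrep (cruxC)
open NE3SmoothRightInverseW (rightInvW)
open NE3RightInverseSolveLetters (thetaLoc)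
open NE3RightInverseL2Letter (l2C)
open NE3HatInvCurlLetters (curl2C curl1C)
open NE3LinearisedAverageSup (curvSum)
open NE3FramePotBoundW (tower_eq_pow_mul)
open BlockAverageVaryDisc (rho0)
open NE7MeanZeroGaugeSliceW (energyBlockLandauW)
open NE7SliceIterationState (repLog cornerLog coarseDatum)
open NE7SliceIterationStateFacts (repLog_skew repLog_periodic coarseDatum_skew_periodic)
open NE3TangentCovariantTower (framePotW)
open NE7SliceIterationState (tangentPart sliceDefect)
open NE7SliceRepresentativeFrames (slice_representative_fm)
open NE7DecompOfDirectLettersSlice (decomp_of_directLetters_coarse)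
open NE7RoutePiRegimeSU2 (thetaLoc_mul_lt_one)

noncomputable section

variable {n : Type*} [Fintype n] [DecidableEq n]

/-- **F4e — `hdecomp♭` FROM (S1) (THEOREM) AND (S2) (THE TWO DIRECT LETTERS, DISPLAYED)**, `d = 4`, `L = 2`: there are k-free `ε₂ > 0`, `C_S > 0` such that for every `0 < ε ≤ ε₂`, every `N`, and every
`q₂ ≥ 0`, `q₁`: IF the direct letters (DL2) `dirSq φ(u) (periodBox N) ≤ q₂²·‖X(u)‖_w²` and (DL1) `dirL1 φ(u) (periodBox N) ≤ q₁·‖X(u)‖_w²` (`M^d∕M⁴ = 1`) hold for the coarse datum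
`φ(u) = coarseDatum 2 k U_s U′ u` of EVERY slice representative `u` of an admissible-type pair (unitary `(tower)`-periodic `U_s`, `U′` at radius `ε∕M²` with the same `(k+1)`-fold average, the class
facts, `u` unitary `(tower)`-periodic with the chart `U′^{u} = U_s e^{X(u)}`, `M‖X(u)‖ ≤ C_S ε`, corners with `‖h(u)‖ ≤ C_S ε`, the line `4·51²·C_S·ε ≤ ρ₀²`, and `X(u) − rightInvW(φ(u)) ∈ 𝒯_E(U_s)`),
THEN the END's binder `hdecomp♭` holds with `α̂ := C_S·ε`, `ν̂ := √(l2C 4 2∕(1 − thetaLoc 4 2·ε)² + curl2C 4 2∕(1 − thetaLoc 4 2·ε)²)·q₂`, `κ̂ := ε·(curl1C 4 2∕(1 − thetaLoc 4 2·ε))·q₁`. [folklore] -/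
theorem hdecomp_of_directLetters_fm [Nonempty n] :
    ∃ ε₂ : ℝ, 0 < ε₂ ∧ ∃ CS : ℝ, 0 < CS ∧ ∀ (N : ℕ) [NeZero N] (ε : ℝ), 0 < ε → ε ≤ ε₂ → ∀ (β q₂ q₁ : ℝ), 0 ≤ q₂ →
      -- (S2): THE TWO DIRECT LETTERS for the coarse datum of every slice representative
      (∀ (k : ℕ) (Us U' : Site 4 → Fin 4 → (Matrix n n ℂ)ˣ) (u : Site 4 → (Matrix n n ℂ)ˣ),
        IsUnitaryCfg Us → IsPeriodicCfg Us ((tower 2 N (k + 1) : ℕ) : ℤ) → SmallField Us (ε / (((2 : ℕ) : ℝ) ^ (k + 1)) ^ 2) →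
        IsUnitaryCfg U' → IsPeriodicCfg U' ((tower 2 N (k + 1) : ℕ) : ℤ) → SmallField U' (ε / (((2 : ℕ) : ℝ) ^ (k + 1)) ^ 2) →
        cavgIter 2 (k + 1) U' = cavgIter 2 (k + 1) Us →
        LevelSmall 4 2 k (ε / (((2 : ℕ) : ℝ) ^ (k + 1)) ^ 2) → LevelSmall 4 2 (k + 1) (ε / (((2 : ℕ) : ℝ) ^ (k + 1)) ^ 2) →
        cruxC 4 2 * ((((2 : ℕ) : ℝ) ^ (k + 1)) ^ 2 * (ε / (((2 : ℕ) : ℝ) ^ (k + 1)) ^ 2)) < 1 → curvSum 4 2 (k + 1) (ε / (((2 : ℕ) : ℝ) ^ (k + 1)) ^ 2) ≤ 2 / 3 * (2 : ℕ) →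
        4 * (3 + 12 * ((4 : ℕ) : ℝ)) ^ 2 * ((2 : ℕ) : ℝ) ^ (k + 1) * (CS * ε / ((2 : ℕ) : ℝ) ^ (k + 1)) ≤ rho0 4 2 ^ 2 →
        IsUnitarySite u → IsPeriodicSite u ((tower 2 N (k + 1) : ℕ) : ℤ) → gaugeAct u U' = vary Us (repLog Us U' u) 1 →
        (∀ (y : Site 4) (κ : Fin 4), ((2 : ℕ) : ℝ) ^ (k + 1) * ‖repLog Us U' u y κ‖ ≤ CS * ε) →
        (∀ z : Site 4, ((u ((((2 : ℕ) : ℤ)) ^ (k + 1) • z) : (Matrix n n ℂ)ˣ) : Matrix n n ℂ) = exp (cornerLog 2 k u z)) → (∀ z : Site 4, ‖cornerLog 2 k u z‖ ≤ CS * ε) →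
        (∀ (hWu' : IsUnitaryCfg Us) (hx' : 0 ≤ ε / (((2 : ℕ) : ℝ) ^ (k + 1)) ^ 2) (hs' : LevelSmall 4 2 k (ε / (((2 : ℕ) : ℝ) ^ (k + 1)) ^ 2))
            (hWx' : SmallField Us (ε / (((2 : ℕ) : ℝ) ^ (k + 1)) ^ 2)) (hθ' : cruxC 4 2 * ((((2 : ℕ) : ℝ) ^ (k + 1)) ^ 2 * (ε / (((2 : ℕ) : ℝ) ^ (k + 1)) ^ 2)) < 1)
            (hφ : IsSkewDir (coarseDatum 2 k Us U' u)),
          (fun y μ => repLog Us U' u y μ - rightInvW (le_refl 2) k hWu' hx' hs' hWx' N hθ' hφ y μ) ∈ energyBlockLandauW (d := 4) (n := n) 2 N (k + 1) Us) →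
        (∀ (hWu' : IsUnitaryCfg Us) (hx' : 0 ≤ ε / (((2 : ℕ) : ℝ) ^ (k + 1)) ^ 2) (hs' : LevelSmall 4 2 k (ε / (((2 : ℕ) : ℝ) ^ (k + 1)) ^ 2))
            (hWx' : SmallField Us (ε / (((2 : ℕ) : ℝ) ^ (k + 1)) ^ 2)) (hθ' : cruxC 4 2 * ((((2 : ℕ) : ℝ) ^ (k + 1)) ^ 2 * (ε / (((2 : ℕ) : ℝ) ^ (k + 1)) ^ 2)) < 1),
          (∀ z : Site 4, framePotW 2 (k + 1) Us (tangentPart (le_refl 2) k hWu' hx' hs' hWx' N hθ' U' u) z = cornerLog 2 k u z) ∧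
            sliceDefect (le_refl 2) k hWu' hx' hs' hWx' N hθ' U' u = 0) →
        (((2 : ℕ) : ℝ) ^ (k + 1)) ^ 4 / (((2 : ℕ) : ℝ) ^ (k + 1)) ^ 4 * dirSq (coarseDatum 2 k Us U' u) (periodBox (d := 4) N)
            ≤ q₂ ^ 2 * energyNormW 2 (k + 1) Us (repLog Us U' u) (periodBox (d := 4) (N * 2 ^ (k + 1))) ^ 2 ∧
          (((2 : ℕ) : ℝ) ^ (k + 1)) ^ 4 / (((2 : ℕ) : ℝ) ^ (k + 1)) ^ 4 * dirL1 (coarseDatum 2 k Us U' u) (periodBox (d := 4) N)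
            ≤ q₁ * energyNormW 2 (k + 1) Us (repLog Us U' u) (periodBox (d := 4) (N * 2 ^ (k + 1))) ^ 2) →
      -- CONCLUSION: the END's `hdecomp♭` with `α̂ := C_S ε`, `ν̂`, `κ̂` as displayed
      ∀ D : Site 4 → Fin 4 → (Matrix n n ℂ)ˣ, IsUnitaryCfg D → IsPeriodicCfg D (N : ℤ) → SmallField D (4 * (Real.exp β - 1)) → ∀ (k : ℕ),
        ∀ Us ∈ admissible (sfClass 4 2 N ε) 2 (k + 1) D, SmallField Us ((1 / ((2 : ℕ) : ℝ) ^ 2 * ε / 2) / (((2 : ℕ) : ℝ) ^ (k + 1)) ^ 2) →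
        (∀ φ : Site 4 → Fin 4 → Matrix n n ℂ, IsSkewDir φ → IsPeriodicDir φ ((N * 2 ^ (k + 1) : ℕ) : ℤ) → TangentIter 2 k Us φ → dAction Us φ (perWin 4 (N * 2 ^ (k + 1))) = 0) →
        ∀ U' ∈ admissible (sfClass 4 2 N ε) 2 (k + 1) D,
        ∀ u₀ : Site 4 → (Matrix n n ℂ)ˣ, IsUnitarySite u₀ → IsPeriodicSite u₀ ((N * 2 ^ (k + 1) : ℕ) : ℤ) → (∀ z : Site 4, u₀ (((2 ^ (k + 1) : ℕ) : ℤ) • z) = 1) →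
          (∀ (x : Site 4) (μ : Fin 4), ‖(((Us x μ)⁻¹ * gaugeAct u₀ U' x μ : (Matrix n n ℂ)ˣ) : Matrix n n ℂ) - 1‖
            ≤ 10000000000000000000000000000000000 * (2 : ℝ) ^ (k + 1) * (ε / (((2 : ℕ) : ℝ) ^ (k + 1)) ^ 2)) →
        ∃ (u : Site 4 → (Matrix n n ℂ)ˣ) (X XT XN : Site 4 → Fin 4 → Matrix n n ℂ) (α ν κ : ℝ),
          IsUnitarySite u ∧ IsSkewDir X ∧ IsPeriodicDir X ((N * 2 ^ (k + 1) : ℕ) : ℤ) ∧ 0 ≤ α ∧ (∀ x μ, ‖X x μ‖ ≤ α) ∧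
          gaugeAct u U' = vary Us X 1 ∧
          X = XT + XN ∧ XT ∈ energyBlockLandauW (d := 4) (n := n) 2 N (k + 1) Us ∧ IsSkewDir XN ∧ 0 ≤ ν ∧
          energyNormW 2 (k + 1) Us XN (periodBox (d := 4) (N * 2 ^ (k + 1)))
            ≤ ν * energyNormW 2 (k + 1) Us X (periodBox (d := 4) (N * 2 ^ (k + 1))) ∧
          ε / (((2 : ℕ) : ℝ) ^ (k + 1)) ^ 2 * (∑ p ∈ perWin 4 (N * 2 ^ (k + 1)), ‖curl Us XN p‖)
            ≤ κ * energyNormW 2 (k + 1) Us X (periodBox (d := 4) (N * 2 ^ (k + 1))) ^ 2 ∧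
          α * ((2 : ℕ) : ℝ) ^ (k + 1) ≤ CS * ε ∧
          ν ≤ Real.sqrt (l2C 4 2 / (1 - thetaLoc 4 2 * ε) ^ 2 + curl2C 4 2 / (1 - thetaLoc 4 2 * ε) ^ 2) * q₂ ∧
          κ ≤ ε * (curl1C 4 2 / (1 - thetaLoc 4 2 * ε)) * q₁ := by
  obtain ⟨ε₂, hε₂, CS, hCS, hrep⟩ := slice_representative_fm (n := n) (d := 3) (by norm_num) (le_refl 2) (bh := 10000000000000000000000000000000000) (by norm_num)
  refine ⟨min ε₂ (min (1 / 10 ^ 53) (1 / (8 * CS + 8))), lt_min hε₂ (lt_min (by norm_num) (by positivity)), CS, hCS, ?_⟩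
  intro N _ ε hε hεle β q₂ q₁ hq₂ hDL D _ _ _ k Us hUs _ _ U' hU' u₀ hu₀ hu₀P hpin hclose
  have hε₂' : ε ≤ ε₂ := hεle.trans (min_le_left _ _)
  have hε53 : ε ≤ 1 / 10 ^ 53 := hεle.trans ((min_le_right _ _).trans (min_le_left _ _))
  have hεCS : ε ≤ 1 / (8 * CS + 8) := hεle.trans ((min_le_right _ _).trans (min_le_right _ _))
  have hε1 : ε ≤ 1 := hε53.trans (by norm_num)
  have hCSε : CS * ε ≤ 1 / 8 := by
    have h1 : CS * ε ≤ CS * (1 / (8 * CS + 8)) := mul_le_mul_of_nonneg_left hεCS hCS.le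
    have h2 : CS * (1 / (8 * CS + 8)) ≤ 1 / 8 := by
      rw [mul_one_div, div_le_iff₀ (by positivity)]; nlinarith
    exact h1.trans h2
  -- the pair's class data
  have hT : (tower 2 N (k + 1) : ℕ) = N * 2 ^ (k + 1) := by rw [tower_eq_pow_mul, Nat.mul_comm]
  obtain ⟨⟨hWu, hWP, hWx⟩, hWavg⟩ := hUs
  obtain ⟨⟨hU'u, hU'P, hU'x⟩, hU'avg⟩ := hU'
  have hWPt : IsPeriodicCfg Us ((tower 2 N (k + 1) : ℕ) : ℤ) := by rw [hT]; exact hWP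
  have hU'Pt : IsPeriodicCfg U' ((tower 2 N (k + 1) : ℕ) : ℤ) := by rw [hT]; exact hU'P
  have htop : cavgIter 2 (k + 1) U' = cavgIter 2 (k + 1) Us := by rw [cavgIter_eq_avgIter, cavgIter_eq_avgIter, hU'avg, hWavg]
  have hu₀Pt : IsPeriodicSite u₀ ((tower 2 N (k + 1) : ℕ) : ℤ) := by rw [hT]; exact hu₀P
  have hpin' : ∀ z : Site 4, u₀ ((((2 : ℕ) : ℤ)) ^ (k + 1) • z) = 1 := fun z => by
    have h := hpin z; rwa [Nat.cast_pow] at h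
  have hclose' : ∀ (x : Site 4) (μ : Fin 4), ‖(((Us x μ)⁻¹ * gaugeAct u₀ U' x μ : (Matrix n n ℂ)ˣ) : Matrix n n ℂ) - 1‖
      ≤ 10000000000000000000000000000000000 * ((2 : ℕ) : ℝ) ^ (k + 1) * (ε / (((2 : ℕ) : ℝ) ^ (k + 1)) ^ 2) := fun x μ => by
    have h := hclose x μ; rwa [show (2 : ℝ) = ((2 : ℕ) : ℝ) by norm_num] at h
  -- (S1): the slice representative
  obtain ⟨hsk, hsk1, hθ, hA, hρl, u, hu, huP, hgauge, hXM, hcorner, hh, hslice, hfm⟩ :=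
    hrep k N Us U' ε hε hε₂' hWu hWPt hWx hU'u hU'Pt hU'x hu₀ hu₀Pt hpin' hclose'
  -- sizes of the representative
  have hM0 : (0 : ℝ) < ((2 : ℕ) : ℝ) ^ (k + 1) := by positivity
  have hM1 : (1 : ℝ) ≤ ((2 : ℕ) : ℝ) ^ (k + 1) := one_le_pow₀ (by norm_num)
  have hx : 0 ≤ ε / (((2 : ℕ) : ℝ) ^ (k + 1)) ^ 2 := by positivity
  have hsup : ∀ (y : Site 4) (κ : Fin 4), ‖repLog Us U' u y κ‖ ≤ CS * ε / ((2 : ℕ) : ℝ) ^ (k + 1) := fun y κ => by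
    rw [le_div_iff₀ hM0, mul_comm]; exact hXM y κ
  have hX8 : ∀ (y : Site 4) (κ : Fin 4), ‖repLog Us U' u y κ‖ ≤ 1 / 8 := fun y κ =>
    (hsup y κ).trans ((div_le_self (by positivity) hM1).trans hCSε)
  have hh8 : ∀ z : Site 4, ‖cornerLog 2 k u z‖ ≤ 1 / 8 := fun z => (hh z).trans hCSε
  have hXs := repLog_skew hWu U' hU'u hu hgauge hX8
  have hXP : IsPeriodicDir (repLog Us U' u) ((N * 2 ^ (k + 1) : ℕ) : ℤ) := by rw [← hT]; exact repLog_periodic k N U' hWPt hU'Pt huP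
  have hφ := (coarseDatum_skew_periodic (le_refl 2) k hWu hx hsk hWx N U' hWPt hU'u hU'Pt hu huP hgauge hX8 hcorner hh8).1
  -- (S2): the direct letters for this representative
  obtain ⟨hDL2, hDL1⟩ := hDL k Us U' u hWu hWPt hWx hU'u hU'Pt hU'x htop hsk hsk1 hθ hA hρl hu huP hgauge hXM hcorner hh hslice hfm
  -- the junction
  have hθl : thetaLoc 4 2 * ε < 1 := thetaLoc_mul_lt_one hε hε53
  obtain ⟨u', X, XT, XN, α, ν, κ, hu', hXs', hXP', hα, hXα, hg', hXdec, hXT, hXN, hν, hN1, hN2, hαeq, hνeq, hκeq⟩ :=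
    decomp_of_directLetters_coarse (d := 4) (L := 2) (N := N) (le_refl 2) k hε hsk hθl hε1 (Us := Us) (U' := U') ⟨hWu, hWP, hWx⟩
      (fun j W => energyBlockLandauW (d := 4) (n := n) 2 N (j + 1) W) (fun Y hY => hY.1) hφ hq₂ hu hgauge hXs hXP (by positivity) hsup hslice hDL2 hDL1
  refine ⟨u', X, XT, XN, α, ν, κ, hu', hXs', hXP', hα, hXα, hg', hXdec, hXT, hXN, hν, hN1, hN2, ?_, le_of_eq hνeq, le_of_eq hκeq⟩
  rw [hαeq]; exact le_of_eq (by field_simp)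

end

end Summit.QuantumFields.BalabanUV.T4Continuum.NE7HdecompOfDirectLettersFM
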